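import Literature.Computability.QuantumComplexity.GadgetDesc
import HarnessLib

/-!
# Printing the descriptions of copy layers and `NOT` layers in polynomial time

Topic `Literature/Computability/QuantumComplexity`; sibling of `SwapDesc.lean` / `GadgetDesc.lean` (the swap of a front
window with a block at a data-dependent offset, printed at the string level by a counted concatenation
fold). The chain combinator of `SeqChain.lean` assembles, before every stage `k`, the stage input
`⟨x, ⟨1ᵏ, y_k⟩⟩` in block `k` by three layers whose offsets depend on `k` and so — like the swaps — are
printed at the string level by folds of `FoldBricks.lean` (Arora–Barak 2009, §6.1, §1.3):

* `dupDescFn` — **the doubling copy** `CNOT i (D + 2i); CNOT i (D + 2i + 1)`, `i < n` (the doubled bits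
  of the first component of a `boolPair`): `⟨bin D, 1ⁿ⟩ ↦ (…).flatMap opBits`;
* `notsDescFn` — **a run of `NOT`s** `NOT (D + j)`, `j < L`: `⟨bin D, 1ᴸ⟩ ↦ (…).flatMap opBits`
  (with `notBitsFn`: the bits `opBits (NOT p)` of the compiled word `H S S H` of one `NOT`, from `bin p`,
  via `GadgetDesc.gateBits_one`; a plain-function companion of the bundled `GadgetDesc.notWord`);
* `shiftDescFn` — **the shifted copy** `CNOT (S + j) (D + j)`, `j < L` (the window of the previous
  block): `⟨⟨bin S, bin D⟩, 1ᴸ⟩ ↦ (…).flatMap opBits`.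

Each with `_apply` (value as a `ccat`), `_mem_FP`, built exactly as `SwapDesc.swapDescFn`.

## References

* S. Arora, B. Barak, *Computational Complexity: A Modern Approach*, CUP 2009, §6.1 (descriptions
  of circuits), §1.3 (bounded loops) [AroraBarak2009].
* M. A. Nielsen, I. L. Chuang, *Quantum Computation and Quantum Information*, CUP 2010, §1.3.4
  (`CNOT` copies classical bits), §4.3 Fig. 4.9 [NielsenChuang2010].
-/

noncomputable section

namespace Literature.Computability.QuantumComplexity

open _root_.Computability Polynomial Complexity Complexity.Brick Plumb RevDesc SProg SwapDesc

namespace CopyDesc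

/-! ### The bits of one `NOT` word -/

/-- **The bits of `NOT p` in a circuit description**: the words of `H S S H` on wire `p`.
[cite: NielsenChuang2010, §4.3 Fig. 4.9 (X = HSSH)] -/
theorem opBits_not (p : ℕ) :
    opBits (ClOp.not p) = (gatePre 0 1 ++ boolPair (boolPair (encodeNat p) []) []) ++
      ((gatePre 1 1 ++ boolPair (boolPair (encodeNat p) []) []) ++
        ((gatePre 1 1 ++ boolPair (boolPair (encodeNat p) []) []) ++
          (gatePre 0 1 ++ boolPair (boolPair (encodeNat p) []) []))) := by
  have h : opBits (ClOp.not p) = gateBits 0 1 [p] ++ (gateBits 1 1 [p] ++ (gateBits 1 1 [p] ++ (gateBits 0 1 [p] ++ []))) := by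
    simp [opBits, agates, AGate.bits, symCode, symArity]
  rw [h, List.append_nil, GadgetDesc.gateBits_one, GadgetDesc.gateBits_one]

/-- The string function `a ↦ gatePre s 1 ++ ⟨⟨a, []⟩, []⟩`. [folklore] -/
def wordFn (s : ℕ) : List Bool → List Bool :=
  appF ∘ fanoutFn (fun _ => gatePre s 1) (fanoutFn (fanoutFn (fun a => a) (fun _ => [])) (fun _ => []))

/-- Value of `wordFn`. [folklore] -/
@[simp] theorem wordFn_apply (s : ℕ) (a : List Bool) : wordFn s a = gatePre s 1 ++ boolPair (boolPair a []) [] := by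
  simp [wordFn, fanoutFn_apply]

/-- `wordFn s ∈ FP`. [folklore] -/
theorem wordFn_mem_FP (s : ℕ) : wordFn s ∈ FP :=
  comp_mem_FP appF_mem_FP (fanoutFn_mem_FP (const_mem_FP _)
    (fanoutFn_mem_FP (fanoutFn_mem_FP (PolyTimeComputable.id _) (const_mem_FP _)) (const_mem_FP _)))

/-- **The string function `bin p ↦ opBits (NOT p)`.** [folklore] -/
def notBitsFn : List Bool → List Bool :=
  appF ∘ fanoutFn (wordFn 0) (appF ∘ fanoutFn (wordFn 1) (appF ∘ fanoutFn (wordFn 1) (wordFn 0)))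

/-- Value of `notBitsFn` on an arbitrary string. [folklore] -/
theorem notBitsFn_apply' (a : List Bool) :
    notBitsFn a = (gatePre 0 1 ++ boolPair (boolPair a []) []) ++ ((gatePre 1 1 ++ boolPair (boolPair a []) []) ++
      ((gatePre 1 1 ++ boolPair (boolPair a []) []) ++ (gatePre 0 1 ++ boolPair (boolPair a []) []))) := by
  simp [notBitsFn, fanoutFn_apply]

/-- Value of `notBitsFn` on numerals: the bits of the `NOT` word. [folklore] -/
theorem notBitsFn_apply (p : ℕ) : notBitsFn (encodeNat p) = opBits (ClOp.not p) := by
  rw [notBitsFn_apply', opBits_not]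

/-- `notBitsFn ∈ FP`. [folklore] -/
theorem notBitsFn_mem_FP : notBitsFn ∈ FP :=
  comp_mem_FP appF_mem_FP (fanoutFn_mem_FP (wordFn_mem_FP 0) (comp_mem_FP appF_mem_FP (fanoutFn_mem_FP (wordFn_mem_FP 1)
    (comp_mem_FP appF_mem_FP (fanoutFn_mem_FP (wordFn_mem_FP 1) (wordFn_mem_FP 0))))))

/-- Length of `notBitsFn a`: linear in `|a|`. [folklore] -/
theorem length_notBitsFn (a : List Bool) :
    (notBitsFn a).length = 2 * (gatePre 0 1).length + 2 * (gatePre 1 1).length + (16 * a.length + 24) := by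
  rw [notBitsFn_apply']
  simp only [List.length_append, length_boolPair, List.length_nil]
  ring

/-- Length of the bits of a `NOT` word. [folklore] -/
theorem length_opBits_not (p : ℕ) :
    (opBits (ClOp.not p)).length = 2 * (gatePre 0 1).length + 2 * (gatePre 1 1).length + (16 * (encodeNat p).length + 24) := by
  rw [← notBitsFn_apply, length_notBitsFn]

/-! ### A run of `NOT`s -/

/-- The piece of index `j` on the context `x = ⟨bin D, 1ᴸ⟩`: the word of `NOT (D + j)`. [folklore] -/
def notsPieceFn : List Bool → List Bool :=
  notBitsFn ∘ addFn ∘ fanoutFn (fstF ∘ fstF) (lenBinF ∘ sndF)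

/-- Value of the piece. [folklore] -/
theorem notsPieceFn_apply (b u : List Bool) (j : ℕ) :
    notsPieceFn (boolPair (boolPair b u) (ones j)) = opBits (ClOp.not (bitsToNat b + j)) := by
  simp [notsPieceFn, fanoutFn_apply, ones, notBitsFn_apply]

/-- `notsPieceFn ∈ FP`. [folklore] -/
theorem notsPieceFn_mem_FP : notsPieceFn ∈ FP :=
  comp_mem_FP notBitsFn_mem_FP (comp_mem_FP addFn_mem_FP (fanoutFn_mem_FP (comp_mem_FP fstF_mem_FP fstF_mem_FP)
    (comp_mem_FP lenBinF_mem_FP sndF_mem_FP)))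

/-- The clipping constant of the `NOT` run. [folklore] -/
def notsClipC : ℕ := 2 * (gatePre 0 1).length + 2 * (gatePre 1 1).length + 40

/-- Actual pieces are short. [folklore] -/
theorem length_notsPieceFn_le (b u : List Bool) {j : ℕ} (hj : j ≤ u.length) :
    (notsPieceFn (boolPair (boolPair b u) (ones j))).length ≤ notsClipC * ((boolPair b u).length + 1) := by
  have h2 : (encodeNat (bitsToNat b + j)).length ≤ b.length + u.length + 1 := by
    have h := length_encodeNat_add_le b (encodeNat j)
    rw [bitsToNat_encodeNat] at h
    have h1 : (encodeNat j).length ≤ u.length := (length_encodeNat_le_self j).trans hj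
    omega
  rw [notsPieceFn_apply, length_opBits_not, length_boolPair, notsClipC]
  nlinarith [h2, Nat.zero_le (gatePre 0 1).length, Nat.zero_le (gatePre 1 1).length, Nat.zero_le b.length, Nat.zero_le u.length]

/-- **The `NOT`-run description function**: on `⟨bin D, 1ᴸ⟩`, fold the pieces `j < L` by concatenation.
[cite: AroraBarak2009, §1.3 (bounded loops)] -/
def notsDescFn : List Bool → List Bool :=
  sndPow 2 ∘ foldLoop appF (clipF notsClipC notsPieceFn) X ∘
    fanoutFn (fun w => w) (fanoutFn (lenBinF ∘ sndF) (fun _ => boolPair [] []))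

/-- `notsDescFn ∈ FP`. [folklore] -/
theorem notsDescFn_mem_FP : notsDescFn ∈ FP :=
  comp_mem_FP (sndPow_mem_FP 2) (comp_mem_FP (foldLoop_clipF_mem_FP notsClipC appF_mem_FP length_appF_le notsPieceFn_mem_FP X)
    (fanoutFn_mem_FP (PolyTimeComputable.id _) (fanoutFn_mem_FP (comp_mem_FP lenBinF_mem_FP sndF_mem_FP) (const_mem_FP _))))

/-- **`notsDescFn ⟨bin D, 1ᴸ⟩` is the description of `NOT (D + j)`, `j < L`.** [cite: AroraBarak2009, §6.1] -/
theorem notsDescFn_apply (D L : ℕ) :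
    notsDescFn (boolPair (encodeNat D) (ones L)) = ccat (fun j => opBits (ClOp.not (D + j))) L := by
  have h0 : fanoutFn (fun w => w) (fanoutFn (lenBinF ∘ sndF) (fun _ => boolPair [] [])) (boolPair (encodeNat D) (ones L)) =
      boolPair (boolPair (encodeNat D) (ones L)) (boolPair (encodeNat L) (boolPair (ones 0) [])) := by
    simp [fanoutFn_apply, ones]
  rw [notsDescFn, Function.comp_apply, Function.comp_apply, h0,
    foldLoop_apply appF (clipF notsClipC notsPieceFn) (by simp [ones]) 0 [],
    sndPow_succ_boolPair, sndPow_succ_boolPair, sndPow_zero_boolPair,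
    foldAcc_clipF (fun j _ hj => length_notsPieceFn_le _ _ (by simp [ones] at hj ⊢; omega)), foldAcc_appF,
    List.nil_append]
  refine ccat_congr fun j _ => ?_
  rw [Nat.zero_add, notsPieceFn_apply, bitsToNat_encodeNat]

/-! ### The doubling copy -/

/-- The piece of index `i` on the context `x = ⟨bin D, 1ⁿ⟩`: the words of `CNOT i (D + 2i)` and
`CNOT i (D + 2i + 1)`. [folklore] -/
def dupPieceFn : List Bool → List Bool :=
  appF ∘ fanoutFn
    (cnotBitsFn ∘ fanoutFn (lenBinF ∘ sndF) (addFn ∘ fanoutFn (fstF ∘ fstF) (lenBinF ∘ appF ∘ fanoutFn sndF sndF)))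
    (cnotBitsFn ∘ fanoutFn (lenBinF ∘ sndF) (addFn ∘ fanoutFn (fstF ∘ fstF) (lenBinF ∘ List.cons true ∘ appF ∘ fanoutFn sndF sndF)))

/-- Value of the piece. [folklore] -/
theorem dupPieceFn_apply (b u : List Bool) (i : ℕ) :
    dupPieceFn (boolPair (boolPair b u) (ones i)) =
      opBits (ClOp.cnot i (bitsToNat b + 2 * i)) ++ opBits (ClOp.cnot i (bitsToNat b + (2 * i + 1))) := by
  simp [dupPieceFn, fanoutFn_apply, ones, cnotBitsFn_apply, two_mul]

/-- `dupPieceFn ∈ FP`. [folklore] -/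
theorem dupPieceFn_mem_FP : dupPieceFn ∈ FP := by
  have hss : appF ∘ fanoutFn sndF sndF ∈ FP := comp_mem_FP appF_mem_FP (fanoutFn_mem_FP sndF_mem_FP sndF_mem_FP)
  have hff : fstF ∘ fstF ∈ FP := comp_mem_FP fstF_mem_FP fstF_mem_FP
  refine comp_mem_FP appF_mem_FP (fanoutFn_mem_FP ?_ ?_)
  · exact comp_mem_FP cnotBitsFn_mem_FP (fanoutFn_mem_FP (comp_mem_FP lenBinF_mem_FP sndF_mem_FP)
      (comp_mem_FP addFn_mem_FP (fanoutFn_mem_FP hff (comp_mem_FP lenBinF_mem_FP hss))))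
  · exact comp_mem_FP cnotBitsFn_mem_FP (fanoutFn_mem_FP (comp_mem_FP lenBinF_mem_FP sndF_mem_FP)
      (comp_mem_FP addFn_mem_FP (fanoutFn_mem_FP hff (comp_mem_FP lenBinF_mem_FP (comp_mem_FP (cons_mem_FP true) hss)))))

/-- The clipping constant of the doubling copy. [folklore] -/
def dupClipC : ℕ := 2 * (gatePre 3 2).length + 60

/-- Actual pieces are short. [folklore] -/
theorem length_dupPieceFn_le (b u : List Bool) {i : ℕ} (hi : i ≤ u.length) :
    (dupPieceFn (boolPair (boolPair b u) (ones i))).length ≤ dupClipC * ((boolPair b u).length + 1) := by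
  have h1 : (encodeNat i).length ≤ u.length := (length_encodeNat_le_self i).trans hi
  have hA : ∀ t, t ≤ 2 * u.length + 1 → (encodeNat (bitsToNat b + t)).length ≤ b.length + 2 * u.length + 2 := by
    intro t ht
    have h := length_encodeNat_add_le b (encodeNat t)
    rw [bitsToNat_encodeNat] at h
    have := (length_encodeNat_le_self t).trans ht
    omega
  have h2 := hA (2 * i) (by omega)
  have h3 := hA (2 * i + 1) (by omega)
  rw [dupPieceFn_apply, List.length_append, length_opBits_cnot, length_opBits_cnot, length_boolPair, dupClipC]
  nlinarith [h1, h2, h3, Nat.zero_le (gatePre 3 2).length, Nat.zero_le b.length, Nat.zero_le u.length]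

/-- **The doubling-copy description function**: on `⟨bin D, 1ⁿ⟩`, fold the pieces `i < n`.
[cite: AroraBarak2009, §1.3 (bounded loops)] -/
def dupDescFn : List Bool → List Bool :=
  sndPow 2 ∘ foldLoop appF (clipF dupClipC dupPieceFn) X ∘
    fanoutFn (fun w => w) (fanoutFn (lenBinF ∘ sndF) (fun _ => boolPair [] []))

/-- `dupDescFn ∈ FP`. [folklore] -/
theorem dupDescFn_mem_FP : dupDescFn ∈ FP :=
  comp_mem_FP (sndPow_mem_FP 2) (comp_mem_FP (foldLoop_clipF_mem_FP dupClipC appF_mem_FP length_appF_le dupPieceFn_mem_FP X)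
    (fanoutFn_mem_FP (PolyTimeComputable.id _) (fanoutFn_mem_FP (comp_mem_FP lenBinF_mem_FP sndF_mem_FP) (const_mem_FP _))))

/-- **`dupDescFn ⟨bin D, 1ⁿ⟩` is the description of `CNOT i (D + 2i); CNOT i (D + 2i + 1)`, `i < n`.**
[cite: AroraBarak2009, §6.1] -/
theorem dupDescFn_apply (D n : ℕ) :
    dupDescFn (boolPair (encodeNat D) (ones n)) =
      ccat (fun i => opBits (ClOp.cnot i (D + 2 * i)) ++ opBits (ClOp.cnot i (D + (2 * i + 1)))) n := by
  have h0 : fanoutFn (fun w => w) (fanoutFn (lenBinF ∘ sndF) (fun _ => boolPair [] [])) (boolPair (encodeNat D) (ones n)) =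
      boolPair (boolPair (encodeNat D) (ones n)) (boolPair (encodeNat n) (boolPair (ones 0) [])) := by
    simp [fanoutFn_apply, ones]
  rw [dupDescFn, Function.comp_apply, Function.comp_apply, h0,
    foldLoop_apply appF (clipF dupClipC dupPieceFn) (by simp [ones]) 0 [],
    sndPow_succ_boolPair, sndPow_succ_boolPair, sndPow_zero_boolPair,
    foldAcc_clipF (fun j _ hj => length_dupPieceFn_le _ _ (by simp [ones] at hj ⊢; omega)), foldAcc_appF,
    List.nil_append]
  refine ccat_congr fun j _ => ?_
  rw [Nat.zero_add, dupPieceFn_apply, bitsToNat_encodeNat]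

/-! ### The shifted copy -/

/-- The piece of index `j` on the context `x = ⟨⟨bin S, bin D⟩, 1ᴸ⟩`: the word of
`CNOT (S + j) (D + j)`. [folklore] -/
def shiftPieceFn : List Bool → List Bool :=
  cnotBitsFn ∘ fanoutFn (addFn ∘ fanoutFn (fstF ∘ fstF ∘ fstF) (lenBinF ∘ sndF))
    (addFn ∘ fanoutFn (sndF ∘ fstF ∘ fstF) (lenBinF ∘ sndF))

/-- Value of the piece. [folklore] -/
theorem shiftPieceFn_apply (a b u : List Bool) (j : ℕ) :
    shiftPieceFn (boolPair (boolPair (boolPair a b) u) (ones j)) =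
      opBits (ClOp.cnot (bitsToNat a + j) (bitsToNat b + j)) := by
  simp [shiftPieceFn, fanoutFn_apply, ones, cnotBitsFn_apply]

/-- `shiftPieceFn ∈ FP`. [folklore] -/
theorem shiftPieceFn_mem_FP : shiftPieceFn ∈ FP :=
  comp_mem_FP cnotBitsFn_mem_FP (fanoutFn_mem_FP
    (comp_mem_FP addFn_mem_FP (fanoutFn_mem_FP (comp_mem_FP fstF_mem_FP (comp_mem_FP fstF_mem_FP fstF_mem_FP))
      (comp_mem_FP lenBinF_mem_FP sndF_mem_FP)))
    (comp_mem_FP addFn_mem_FP (fanoutFn_mem_FP (comp_mem_FP sndF_mem_FP (comp_mem_FP fstF_mem_FP fstF_mem_FP))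
      (comp_mem_FP lenBinF_mem_FP sndF_mem_FP))))

/-- The clipping constant of the shifted copy. [folklore] -/
def shiftClipC : ℕ := (gatePre 3 2).length + 30

/-- Actual pieces are short. [folklore] -/
theorem length_shiftPieceFn_le (a b u : List Bool) {j : ℕ} (hj : j ≤ u.length) :
    (shiftPieceFn (boolPair (boolPair (boolPair a b) u) (ones j))).length ≤ shiftClipC * ((boolPair (boolPair a b) u).length + 1) := by
  have h1 : (encodeNat j).length ≤ u.length := (length_encodeNat_le_self j).trans hj
  have h2 : (encodeNat (bitsToNat a + j)).length ≤ a.length + u.length + 1 := by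
    have h := length_encodeNat_add_le a (encodeNat j); rw [bitsToNat_encodeNat] at h; omega
  have h3 : (encodeNat (bitsToNat b + j)).length ≤ b.length + u.length + 1 := by
    have h := length_encodeNat_add_le b (encodeNat j); rw [bitsToNat_encodeNat] at h; omega
  rw [shiftPieceFn_apply, length_opBits_cnot, length_boolPair, length_boolPair, shiftClipC]
  nlinarith [h1, h2, h3, Nat.zero_le (gatePre 3 2).length, Nat.zero_le a.length, Nat.zero_le b.length, Nat.zero_le u.length]

/-- **The shifted-copy description function**: on `⟨⟨bin S, bin D⟩, 1ᴸ⟩`, fold the pieces `j < L`.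
[cite: AroraBarak2009, §1.3 (bounded loops)] -/
def shiftDescFn : List Bool → List Bool :=
  sndPow 2 ∘ foldLoop appF (clipF shiftClipC shiftPieceFn) X ∘
    fanoutFn (fun w => w) (fanoutFn (lenBinF ∘ sndF) (fun _ => boolPair [] []))

/-- `shiftDescFn ∈ FP`. [folklore] -/
theorem shiftDescFn_mem_FP : shiftDescFn ∈ FP :=
  comp_mem_FP (sndPow_mem_FP 2) (comp_mem_FP (foldLoop_clipF_mem_FP shiftClipC appF_mem_FP length_appF_le shiftPieceFn_mem_FP X)
    (fanoutFn_mem_FP (PolyTimeComputable.id _) (fanoutFn_mem_FP (comp_mem_FP lenBinF_mem_FP sndF_mem_FP) (const_mem_FP _))))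

/-- **`shiftDescFn ⟨⟨bin S, bin D⟩, 1ᴸ⟩` is the description of `CNOT (S + j) (D + j)`, `j < L`.**
[cite: AroraBarak2009, §6.1] -/
theorem shiftDescFn_apply (S D L : ℕ) :
    shiftDescFn (boolPair (boolPair (encodeNat S) (encodeNat D)) (ones L)) =
      ccat (fun j => opBits (ClOp.cnot (S + j) (D + j))) L := by
  have h0 : fanoutFn (fun w => w) (fanoutFn (lenBinF ∘ sndF) (fun _ => boolPair [] []))
        (boolPair (boolPair (encodeNat S) (encodeNat D)) (ones L)) =
      boolPair (boolPair (boolPair (encodeNat S) (encodeNat D)) (ones L)) (boolPair (encodeNat L) (boolPair (ones 0) [])) := by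
    simp [fanoutFn_apply, ones]
  rw [shiftDescFn, Function.comp_apply, Function.comp_apply, h0,
    foldLoop_apply appF (clipF shiftClipC shiftPieceFn) (by simp [ones]) 0 [],
    sndPow_succ_boolPair, sndPow_succ_boolPair, sndPow_zero_boolPair,
    foldAcc_clipF (fun j _ hj => length_shiftPieceFn_le _ _ _ (by simp [ones] at hj ⊢; omega)), foldAcc_appF,
    List.nil_append]
  refine ccat_congr fun j _ => ?_
  rw [Nat.zero_add, shiftPieceFn_apply, bitsToNat_encodeNat, bitsToNat_encodeNat]

end CopyDesc

end Literature.Computability.QuantumComplexity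

end
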